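import Literature.AlgebraicGeometry.Resolution.ExtAnnihilatorLocalization
import Literature.AlgebraicGeometry.Resolution.RegularLocalHeights
import Literature.AlgebraicGeometry.Resolution.SupportDimLocalization
import HarnessLib

/-!
# The global `Ext`-annihilator ideal localizes into the local one (index windows)

Topic: `Literature/AlgebraicGeometry/Resolution` (globalization of Theorem A's ideal
`𝔠(M) = ∏_{q ∈ (n-d, max n 2]} Ann E^q(M)`, `n = dim S`, `d = dim M`, over a regular local ring `S`:
at a prime `𝔭 ⊇ Ann M` the module `M_𝔭` over the regular local ring `S_𝔭` of dimension
`n' = ht 𝔭` and `d' = dim M_𝔭` has its own window `(n'-d', max n' 2]`; since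
`d' + dim S/𝔭 ≤ d` (`SupportDimLocalization.lean`) and `ht 𝔭 + dim S/𝔭 = n`
(`RegularLocalHeights.lean`), the local window lies inside the global one, so `𝔠(M) S_𝔭 ⊆ 𝔠(M_𝔭)`
by `ExtAnnihilatorLocalization.lean` — the compatibility needed to run Kawasaki's global prime
avoidance [Kawasaki2000, La. 5.3] with the `Ext`-annihilators in place of `∏ Ann Hʲ(Hom(·, D))`).

* `Ioc_window_subset` — `(n'-d', max n' 2] ⊆ (n-d, max n 2]`.
* `FreeResolution.map_prod_annihilator_EMod_window_le` — `𝔠(M) · S_𝔭 ⊆ 𝔠(M_𝔭)`.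

[cite: Kawasaki2000, La. 5.3, proof of Thm. 5.1]
-/

noncomputable section

open IsLocalRing Module

universe u

namespace Literature.AlgebraicGeometry.Resolution

variable {S : Type u} [CommRing S] [IsRegularLocalRing S] {M : Type u} [AddCommGroup M] [Module S M]
  [Module.Finite S M]

/-- **The local index window lies in the global one**: with `n = dim S`, `d = dim M`, `n' = ht 𝔭`,
`d' = dim M_𝔭` for a prime `𝔭 ⊇ Ann M` of a regular local ring, `n - d ≤ n' - d'` and `n' ≤ n`.
[cite: Matsumura1987, §5 p. 31] -/
theorem Ioc_window_subset {n d n' d' : ℕ} (hn : ringKrullDim S = n) (hd : Module.supportDim S M = d)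
    (𝔭 : Ideal S) [𝔭.IsPrime] (h𝔭 : Module.annihilator S M ≤ 𝔭) (hn' : 𝔭.height = n')
    (hd' : Module.supportDim (Localization.AtPrime 𝔭) (LocalizedModule 𝔭.primeCompl M) = d') :
    Finset.Ioc (n' - d') (max n' 2) ⊆ Finset.Ioc (n - d) (max n 2) := by
  -- `n' + dim S/𝔭 = n` and `d' + dim S/𝔭 ≤ d`
  haveI : Nontrivial (S ⧸ 𝔭) := Ideal.Quotient.nontrivial_iff.mpr (Ideal.IsPrime.ne_top ‹_›)
  haveI : IsLocalRing (S ⧸ 𝔭) := .of_surjective' _ Ideal.Quotient.mk_surjective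
  obtain ⟨e, he⟩ := exists_nat_cast_eq_ringKrullDim (R := S ⧸ 𝔭)
  have h1 := height_add_ringKrullDim_quotient 𝔭
  rw [hn', he, hn] at h1
  have h1' : n' + e = n := by
    have : ((n' + e : ℕ) : WithBot ℕ∞) = n := by rw [← h1]; rfl
    exact_mod_cast this
  have h2 := supportDim_localizedModule_add_ringKrullDim_quotient_le 𝔭 h𝔭
  rw [hd', he, hd] at h2
  have h2' : d' + e ≤ d := by
    have : ((d' + e : ℕ) : WithBot ℕ∞) ≤ d := by exact_mod_cast h2
    exact_mod_cast this
  intro q hq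
  rw [Finset.mem_Ioc] at hq ⊢
  omega

/-- **`𝔠(M) · S_𝔭 ⊆ 𝔠(M_𝔭)`**: the global `Ext`-annihilator product localizes into the local one.
[cite: Kawasaki2000, La. 5.3, proof of Thm. 5.1] -/
theorem FreeResolution.map_prod_annihilator_EMod_window_le (F : FreeResolution S M) {n d n' d' : ℕ}
    (hn : ringKrullDim S = n) (hd : Module.supportDim S M = d) (𝔭 : Ideal S) [𝔭.IsPrime]
    (h𝔭 : Module.annihilator S M ≤ 𝔭) (hn' : 𝔭.height = n')
    (hd' : Module.supportDim (Localization.AtPrime 𝔭) (LocalizedModule 𝔭.primeCompl M) = d') :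
    (∏ q ∈ Finset.Ioc (n - d) (max n 2), Module.annihilator S (F.EMod q)).map
        (algebraMap S (Localization.AtPrime 𝔭)) ≤
      ∏ q ∈ Finset.Ioc (n' - d') (max n' 2),
        Module.annihilator (Localization.AtPrime 𝔭) ((F.localize 𝔭).EMod q) := by
  refine (Ideal.map_mono (F.prod_annihilator_EMod_anti (Ioc_window_subset hn hd 𝔭 h𝔭 hn' hd'))).trans
    (F.map_prod_annihilator_EMod_le 𝔭 _ fun q hq => ?_)
  rw [Finset.mem_Ioc] at hq
  omega

end Literature.AlgebraicGeometry.Resolution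

end
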